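import Literature.LinearAlgebra.QuadraticForm.LagrangianTransitive
import Literature.LinearAlgebra.Alternating.DarbouxBasis
import HarnessLib

/-!
# `Sp(B)` acts transitively on DUAL PAIRS of isotropic subspaces (Witt's extension theorem for an alternating form)

Topic `LinearAlgebra/QuadraticForm`; namespace `Literature.LinearAlgebra.QuadraticForm` (sequel of `LagrangianTransitive.lean`,
which it consumes, and of `Alternating/DarbouxBasis.lean`).  KERNEL mathematics only: theorems, no definition, no named fact, no
`sorry`.

Setting: `B` alternating (`LinearMap.IsAlt`) and non-degenerate on a finite-dimensional `K`-space `V`; "isotropic" =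
`∀ x y ∈ I, B x y = 0`; `Sp(B)` = the tree's `Heisenberg.PseudoSymplectic.isometries B ≤ GL(V)`.  A **dual isotropic pair**
`(I₁, I₂)` is a pair of isotropic subspaces in perfect duality under `B`: `I₁ ⊓ I₂ᗮ = ⊥` and `I₂ ⊓ I₁ᗮ = ⊥` (e.g. a
transversal Lagrangian pair; the images `(im 𝔫, im 𝔫̄)` of a unipotent root element and its opposite; a pair
`(X₁ × 0, 0 × Y₁)` of a polarisation `X × Y` with `Y₁` the dual block of `X₁`).

[Rangarao1993, §2.1 Lemma 2.1 (iii)–(iv)] treats LAGRANGIAN pairs («If `L₁, L₂` are two transversal Lagrangian subspaces,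
and `v₁, …, vₙ` is a basis of `L₁`, there exists a basis `v_{n+1}, …, v_{2n}` of `L₂` such that `v₁, …, v_{2n}` is a
symplectic basis … `σ` can be extended as a symplectomorphism … mapping `Lᵢ` on `Mᵢ`»; tree: `extendSp`,
`exists_isometry_extending`).  This file proves the WITT-TYPE EXTENSION to dual pairs of any dimension `k ≤ n` — the statement
«`Sp(X)` is transitive on pairs of dual isotropic `k`-subspaces» (equivalently: every partial symplectic basis
`e₁, …, e_k, f₁, …, f_k` extends to a symplectic basis, [Lang2002, Ch. XV §8] / Bourbaki Alg. IX §4 n° 3) — by REDUCTION to the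
Lagrangian case:

* §1 numerics of a dual isotropic pair: `I₁ ⊓ I₂ = ⊥`, `dim I₁ = dim I₂`, `dim (I₁ ⊔ I₂) = 2 dim I₁`, `B|_{I₁ ⊔ I₂}`
  non-degenerate, hence `V = (I₁ ⊕ I₂) ⊕ (I₁ ⊕ I₂)ᗮ` (`isCompl_sup_orthogonal_of_dualPair`);
* §2 `exists_dualPair_sup_eq` — Darboux (`Alternating.exists_symplecticBasis`) inside a non-degenerate subspace `C`: `C = C₁ ⊕ C₂`
  for a dual isotropic pair (the spans of the two halves of a symplectic basis of `B|_C`);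
* §3 `lagrangianPair_of_dualPairs` — for a dual pair `(I₁, I₂)` and a dual pair `(C₁, C₂)` with `C₁ ⊕ C₂ = (I₁ ⊕ I₂)ᗮ`, the
  assembled `(I₂ ⊕ C₁, I₁ ⊕ C₂)` is a TRANSVERSAL LAGRANGIAN PAIR of `V` (isotropy + half dimension ⇒ `ℓᗮ = ℓ`,
  `orthogonal_eq_self_of_isotropic`);
* §4 (private block isomorphism of internal direct sums) and the headline
  **`exists_isometry_map_dualPair_eq`**: dual isotropic pairs `(I₁, I₂)`, `(I₁', I₂')` with `dim I₁ = dim I₁'` ⇒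
  `∃ g ∈ Sp(B), g I₁ = I₁' ∧ g I₂ = I₂'` (extend the block isomorphism `I₂ ⊕ C₁ ≃ I₂' ⊕ C₁'` by Lemma 2.1 (iv) to an
  isometry carrying `I₁ ⊕ C₂` onto `I₁' ⊕ C₂'`; then `g I₁ = (I₁' ⊕ C₂') ⊓ (C₁')ᗮ = I₁'`); primed form with
  `g (I₁ ⊕ I₂)ᗮ = (I₁' ⊕ I₂')ᗮ` (`map_orthogonal_eq_of_mem_isometries`).

Written as piece P4 («polarisation mover») of the cell hodgecm-mathlib's proof of the rank-one theta dichotomy row IV-4(c1)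
(KEY `b4-rank-one-theta-lines-disjoint`): `g₀ ∈ Sp(𝕎)` moving `(im 𝔫̄, im 𝔫)` to a standard block `(X₁ × 0, 0 × Y₁)` of the
polarisation, so that `g₀ (1 + b𝔫) g₀⁻¹` is a Siegel unipotent `unipotentσ`; the model-level corollary lives with its
consumer.  Nothing here is specific to that application.

## References
* [Rangarao1993] R. Ranga Rao, *On some explicit formulas in the theory of Weil representation*, Pacific J. Math. 157 (1993),
  §2.1 Lemma 2.1 (iii)–(iv), §2.2 p. 338.
* [Lang2002] S. Lang, *Algebra*, GTM 211, Ch. XV §8 Thm. 8.1 (Darboux).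
-/

set_option autoImplicit false

namespace Literature.LinearAlgebra.QuadraticForm

universe u v

open Module
open Literature.RepresentationTheory.HeisenbergGroup

variable {K : Type u} [Field K]
variable {V : Type v} [AddCommGroup V] [Module K V]

/-! ## §1 Isotropic spans; the numerics of a dual isotropic pair -/

section DualPair

variable {B : LinearMap.BilinForm K V}

/-- the span of a pairwise `B`-orthogonal (including self-orthogonal) set is isotropic. [folklore] -/
private theorem isotropic_span_of_forall {S : Set V} (h : ∀ x ∈ S, ∀ y ∈ S, B x y = 0) :
    ∀ x ∈ Submodule.span K S, ∀ y ∈ Submodule.span K S, B x y = 0 := by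
  have h1 : ∀ y ∈ S, Submodule.span K S ≤ LinearMap.ker (B.flip y) := fun y hy =>
    Submodule.span_le.2 fun x hx => by
      rw [SetLike.mem_coe, LinearMap.mem_ker]
      exact h x hx y hy
  intro x hx
  have h2 : Submodule.span K S ≤ LinearMap.ker (B x) := Submodule.span_le.2 fun y hy => by
    rw [SetLike.mem_coe, LinearMap.mem_ker]
    exact LinearMap.mem_ker.1 (h1 y hy hx)
  intro y hy
  exact (LinearMap.mem_ker.1 (h2 hy))

variable [FiniteDimensional K V] {I₁ I₂ : Submodule K V}

omit [FiniteDimensional K V] in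
/-- **the members of a dual isotropic pair meet trivially**: `I₁ ⊓ I₂ = ⊥` (an element of `I₁ ∩ I₂` is orthogonal
to `I₂`, and `I₁ ⊓ I₂ᗮ = ⊥`). [cite: Rangarao1993, §2.1 Lemma 2.1 (iii)] -/
theorem inf_eq_bot_of_dualPair (hI₂ : ∀ x ∈ I₂, ∀ y ∈ I₂, B x y = 0) (hd₁ : Disjoint I₁ (B.orthogonal I₂)) :
    I₁ ⊓ I₂ = ⊥ := by
  refine (Submodule.eq_bot_iff _).2 fun x hx => ?_
  have hx' : x ∈ B.orthogonal I₂ := (LinearMap.BilinForm.mem_orthogonal_iff).2 fun z hz => hI₂ z hz x hx.2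
  exact (Submodule.eq_bot_iff _).1 hd₁.eq_bot x ⟨hx.1, hx'⟩

/-- `dim I₁ ≤ dim I₂` for `I₁ ⊓ I₂ᗮ = ⊥` (`dim I₂ᗮ = dim V − dim I₂`). [cite: Rangarao1993, §2.1 Lemma 2.1 (iii)] -/
theorem finrank_le_of_disjoint_orthogonal (hN : B.Nondegenerate) (hd₁ : Disjoint I₁ (B.orthogonal I₂)) :
    finrank K I₁ ≤ finrank K I₂ := by
  have h1 := Submodule.finrank_sup_add_finrank_inf_eq I₁ (B.orthogonal I₂)
  rw [hd₁.eq_bot, finrank_bot, add_zero] at h1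
  have h2 := Submodule.finrank_le (I₁ ⊔ B.orthogonal I₂)
  have h3 := LinearMap.BilinForm.finrank_orthogonal hN I₂
  have h4 := Submodule.finrank_le I₂
  omega

/-- **the members of a dual isotropic pair have the same dimension.** [cite: Rangarao1993, §2.1 Lemma 2.1 (iii)] -/
theorem finrank_eq_of_dualPair (hN : B.Nondegenerate) (hd₁ : Disjoint I₁ (B.orthogonal I₂))
    (hd₂ : Disjoint I₂ (B.orthogonal I₁)) : finrank K I₁ = finrank K I₂ :=
  le_antisymm (finrank_le_of_disjoint_orthogonal hN hd₁) (finrank_le_of_disjoint_orthogonal hN hd₂)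

/-- `dim (I₁ ⊔ I₂) = 2 · dim I₁` for a dual isotropic pair. [cite: Rangarao1993, §2.1 Lemma 2.1 (iii)] -/
theorem finrank_sup_of_dualPair (hN : B.Nondegenerate) (hI₂ : ∀ x ∈ I₂, ∀ y ∈ I₂, B x y = 0)
    (hd₁ : Disjoint I₁ (B.orthogonal I₂)) (hd₂ : Disjoint I₂ (B.orthogonal I₁)) :
    finrank K ↥(I₁ ⊔ I₂) = 2 * finrank K I₁ := by
  have h1 := Submodule.finrank_sup_add_finrank_inf_eq I₁ I₂
  rw [inf_eq_bot_of_dualPair hI₂ hd₁, finrank_bot, add_zero, ← finrank_eq_of_dualPair hN hd₁ hd₂] at h1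
  omega

/-- **a dual isotropic pair spans a NON-DEGENERATE subspace**: `B` restricted to `I₁ ⊔ I₂` is non-degenerate
(`w = a + b` orthogonal to `I₂` forces `a ∈ I₁ ⊓ I₂ᗮ = ⊥`, orthogonal to `I₁` forces `b = 0`). [cite: Rangarao1993, §2.1 Lemma 2.1 (iii)] -/
theorem restrict_sup_nondegenerate_of_dualPair (hB : LinearMap.IsAlt B) (hI₁ : ∀ x ∈ I₁, ∀ y ∈ I₁, B x y = 0)
    (hI₂ : ∀ x ∈ I₂, ∀ y ∈ I₂, B x y = 0) (hd₁ : Disjoint I₁ (B.orthogonal I₂)) (hd₂ : Disjoint I₂ (B.orthogonal I₁)) :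
    (B.restrict (I₁ ⊔ I₂)).Nondegenerate := by
  refine LinearMap.BilinForm.Nondegenerate.ofSeparatingLeft fun w hw => ?_
  obtain ⟨a, ha, b, hb, hab⟩ := Submodule.mem_sup.1 w.2
  -- `a` is orthogonal to `I₂`, `b` to `I₁`
  have ha0 : a ∈ B.orthogonal I₂ := by
    rw [LinearMap.BilinForm.mem_orthogonal_iff]
    intro z hz
    have h := hw ⟨z, Submodule.mem_sup_right hz⟩
    change B w z = 0 at h
    rw [← hab, map_add, LinearMap.add_apply, hI₂ b hb z hz, add_zero] at h
    -- `B a z = 0 ⇒ B z a = 0`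
    exact hB.isRefl a z h
  have ha' : a = 0 := (Submodule.eq_bot_iff _).1 hd₁.eq_bot a ⟨ha, ha0⟩
  have hb0 : b ∈ B.orthogonal I₁ := by
    rw [LinearMap.BilinForm.mem_orthogonal_iff]
    intro z hz
    have h := hw ⟨z, Submodule.mem_sup_left hz⟩
    change B w z = 0 at h
    rw [← hab, map_add, LinearMap.add_apply, hI₁ a ha z hz, zero_add] at h
    exact hB.isRefl b z h
  have hb' : b = 0 := (Submodule.eq_bot_iff _).1 hd₂.eq_bot b ⟨hb, hb0⟩
  exact Subtype.ext (by rw [← hab, ha', hb', add_zero]; rfl)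

/-- hence `V = (I₁ ⊔ I₂) ⊕ (I₁ ⊔ I₂)ᗮ`. [cite: Rangarao1993, §2.1 Lemma 2.1 (iii)] -/
theorem isCompl_sup_orthogonal_of_dualPair (hB : LinearMap.IsAlt B) (hI₁ : ∀ x ∈ I₁, ∀ y ∈ I₁, B x y = 0)
    (hI₂ : ∀ x ∈ I₂, ∀ y ∈ I₂, B x y = 0) (hd₁ : Disjoint I₁ (B.orthogonal I₂)) (hd₂ : Disjoint I₂ (B.orthogonal I₁)) :
    IsCompl (I₁ ⊔ I₂) (B.orthogonal (I₁ ⊔ I₂)) :=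
  LinearMap.BilinForm.isCompl_orthogonal_of_restrict_nondegenerate hB.isRefl
    (restrict_sup_nondegenerate_of_dualPair hB hI₁ hI₂ hd₁ hd₂)

end DualPair


/-! ## §2 A non-degenerate subspace is the sum of a dual isotropic pair (Darboux) -/

section Darboux

variable [FiniteDimensional K V] {B : LinearMap.BilinForm K V}

/-- **Darboux inside a non-degenerate subspace**: if `C ⊕ Cᗮ = V` then `C = C₁ ⊕ C₂` for a dual isotropic pair
`(C₁, C₂)` (the spans of the two halves of a symplectic basis of `(C, B|_C)`; `B(e_i, f_j) = δ_ij` gives the duality).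
[cite: Lang2002, Ch. XV §8 Thm. 8.1] -/
theorem exists_dualPair_sup_eq (hB : LinearMap.IsAlt B) {C : Submodule K V} (hC : IsCompl C (B.orthogonal C)) :
    ∃ C₁ C₂ : Submodule K V, C₁ ≤ C ∧ C₂ ≤ C ∧ (∀ x ∈ C₁, ∀ y ∈ C₁, B x y = 0) ∧ (∀ x ∈ C₂, ∀ y ∈ C₂, B x y = 0) ∧
      Disjoint C₁ (B.orthogonal C₂) ∧ Disjoint C₂ (B.orthogonal C₁) ∧ C₁ ⊔ C₂ = C := by
  classical
  have hres : (B.restrict C).Nondegenerate :=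
    (LinearMap.BilinForm.restrict_nondegenerate_iff_isCompl_orthogonal hB.isRefl).2 hC
  have halt : (B.restrict C).IsAlt := fun x => hB (x : V)
  obtain ⟨ι, _, _, b, h11, h22, h12, h21⟩ := Literature.LinearAlgebra.Alternating.exists_symplecticBasis halt hres
  -- the two halves, as vectors of `V`
  set f : ι ⊕ ι → V := fun k => (b k : V) with hf
  have hf11 : ∀ i j, B (f (.inl i)) (f (.inl j)) = 0 := h11
  have hf22 : ∀ i j, B (f (.inr i)) (f (.inr j)) = 0 := h22
  have hf12 : ∀ i j, B (f (.inl i)) (f (.inr j)) = if i = j then 1 else 0 := h12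
  have hf21 : ∀ i j, B (f (.inr i)) (f (.inl j)) = if i = j then -1 else 0 := h21
  refine ⟨Submodule.span K (Set.range (f ∘ Sum.inl)), Submodule.span K (Set.range (f ∘ Sum.inr)), ?_, ?_, ?_, ?_, ?_, ?_, ?_⟩
  · exact Submodule.span_le.2 (by rintro _ ⟨i, rfl⟩; exact (b (Sum.inl i)).2)
  · exact Submodule.span_le.2 (by rintro _ ⟨i, rfl⟩; exact (b (Sum.inr i)).2)
  · exact isotropic_span_of_forall (by rintro _ ⟨i, rfl⟩ _ ⟨j, rfl⟩; exact hf11 i j)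
  · exact isotropic_span_of_forall (by rintro _ ⟨i, rfl⟩ _ ⟨j, rfl⟩; exact hf22 i j)
  · -- `x = Σ μ_i e_i` with `B(f_j, x) = -μ_j = 0`
    rw [Submodule.disjoint_def]
    intro x hx hx'
    obtain ⟨μ, rfl⟩ := (Submodule.mem_span_range_iff_exists_fun K).1 hx
    have hμ : ∀ j, μ j = 0 := fun j => by
      have h := (LinearMap.BilinForm.mem_orthogonal_iff.1 hx') (f (.inr j)) (Submodule.subset_span ⟨j, rfl⟩)
      change B (f (.inr j)) (∑ i, μ i • (f ∘ Sum.inl) i) = 0 at h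
      simp only [map_sum, map_smul, smul_eq_mul, Function.comp_apply, hf21, mul_ite, mul_neg, mul_one, mul_zero,
        Finset.sum_ite_eq, Finset.mem_univ, if_true, neg_eq_zero] at h
      exact h
    simp only [hμ, zero_smul, Finset.sum_const_zero]
  · rw [Submodule.disjoint_def]
    intro x hx hx'
    obtain ⟨μ, rfl⟩ := (Submodule.mem_span_range_iff_exists_fun K).1 hx
    have hμ : ∀ j, μ j = 0 := fun j => by
      have h := (LinearMap.BilinForm.mem_orthogonal_iff.1 hx') (f (.inl j)) (Submodule.subset_span ⟨j, rfl⟩)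
      change B (f (.inl j)) (∑ i, μ i • (f ∘ Sum.inr) i) = 0 at h
      simp only [map_sum, map_smul, smul_eq_mul, Function.comp_apply, hf12, mul_ite, mul_one, mul_zero,
        Finset.sum_ite_eq, Finset.mem_univ, if_true] at h
      exact h
    simp only [hμ, zero_smul, Finset.sum_const_zero]
  · -- the whole basis spans `C`
    rw [← Submodule.span_union, ← Set.Sum.elim_range]
    have hfe : Sum.elim (f ∘ Sum.inl) (f ∘ Sum.inr) = f := by
      ext k; rcases k with i | i <;> rfl
    rw [hfe, hf, show (fun k => (b k : V)) = C.subtype ∘ b from rfl, Set.range_comp, Submodule.span_image,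
      b.span_eq, Submodule.map_top, Submodule.range_subtype]

end Darboux

/-! ## §3 A dual isotropic pair and a dual pair of its complement assemble to a transversal Lagrangian pair -/

section Assemble

variable [FiniteDimensional K V] {B : LinearMap.BilinForm K V} {I₁ I₂ C₁ C₂ : Submodule K V}

omit [FiniteDimensional K V] in
/-- `I₂ ⊔ C₁` is isotropic for `I₂` isotropic, `C₁` isotropic and `C₁ ≤ (I₁ ⊔ I₂)ᗮ`. [cite: Rangarao1993, §2.1 Lemma 2.1 (iii)] -/
theorem isotropic_sup_of_le_orthogonal (hB : LinearMap.IsAlt B) (hI₂ : ∀ x ∈ I₂, ∀ y ∈ I₂, B x y = 0)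
    (hC₁ : ∀ x ∈ C₁, ∀ y ∈ C₁, B x y = 0) (hle : C₁ ≤ B.orthogonal (I₁ ⊔ I₂)) :
    ∀ x ∈ I₂ ⊔ C₁, ∀ y ∈ I₂ ⊔ C₁, B x y = 0 := by
  intro x hx y hy
  obtain ⟨a, ha, c, hc, rfl⟩ := Submodule.mem_sup.1 hx
  obtain ⟨a', ha', c', hc', rfl⟩ := Submodule.mem_sup.1 hy
  have h1 : B a c' = 0 :=
    (LinearMap.BilinForm.mem_orthogonal_iff.1 (hle hc')) a (Submodule.mem_sup_right ha)
  have h2 : B c a' = 0 :=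
    hB.isRefl _ _ ((LinearMap.BilinForm.mem_orthogonal_iff.1 (hle hc)) a' (Submodule.mem_sup_right ha'))
  simp only [map_add, LinearMap.add_apply, hI₂ a ha a' ha', h1, h2, hC₁ c hc c' hc', add_zero]

/-- **the assembled pair `(I₂ ⊔ C₁, I₁ ⊔ C₂)` is a TRANSVERSAL LAGRANGIAN PAIR** of `V`, for a dual isotropic pair
`(I₁, I₂)` and a dual isotropic pair `(C₁, C₂)` with `C₁ ⊔ C₂ = (I₁ ⊔ I₂)ᗮ`. [cite: Rangarao1993, §2.1 Lemma 2.1 (iii)–(iv)] -/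
theorem lagrangianPair_of_dualPairs (hB : LinearMap.IsAlt B) (hN : B.Nondegenerate)
    (hI₁ : ∀ x ∈ I₁, ∀ y ∈ I₁, B x y = 0) (hI₂ : ∀ x ∈ I₂, ∀ y ∈ I₂, B x y = 0)
    (hd₁ : Disjoint I₁ (B.orthogonal I₂)) (hd₂ : Disjoint I₂ (B.orthogonal I₁))
    (hC₁ : ∀ x ∈ C₁, ∀ y ∈ C₁, B x y = 0) (hC₂ : ∀ x ∈ C₂, ∀ y ∈ C₂, B x y = 0)
    (he₁ : Disjoint C₁ (B.orthogonal C₂)) (he₂ : Disjoint C₂ (B.orthogonal C₁)) (hsup : C₁ ⊔ C₂ = B.orthogonal (I₁ ⊔ I₂)) :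
    B.orthogonal (I₂ ⊔ C₁) = I₂ ⊔ C₁ ∧ B.orthogonal (I₁ ⊔ C₂) = I₁ ⊔ C₂ ∧ IsCompl (I₂ ⊔ C₁) (I₁ ⊔ C₂) := by
  have hWC := isCompl_sup_orthogonal_of_dualPair hB hI₁ hI₂ hd₁ hd₂
  have hC₁le : C₁ ≤ B.orthogonal (I₁ ⊔ I₂) := hsup ▸ le_sup_left
  have hC₂le : C₂ ≤ B.orthogonal (I₁ ⊔ I₂) := hsup ▸ le_sup_right
  -- dimensions
  have hW := finrank_sup_of_dualPair hN hI₂ hd₁ hd₂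
  have hC : finrank K ↥(C₁ ⊔ C₂) = 2 * finrank K C₁ := finrank_sup_of_dualPair hN hC₂ he₁ he₂
  have hVWC : finrank K ↥(I₁ ⊔ I₂) + finrank K ↥(B.orthogonal (I₁ ⊔ I₂)) = finrank K V :=
    Submodule.finrank_add_eq_of_isCompl hWC
  rw [← hsup] at hVWC
  have h12 := finrank_eq_of_dualPair hN hd₁ hd₂
  have hc12 := finrank_eq_of_dualPair hN he₁ he₂
  have hdisj₁ : I₂ ⊓ C₁ = ⊥ :=
    (Submodule.eq_bot_iff _).2 fun x hx => (Submodule.eq_bot_iff _).1 hWC.inf_eq_bot x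
      ⟨Submodule.mem_sup_right hx.1, hC₁le hx.2⟩
  have hdisj₂ : I₁ ⊓ C₂ = ⊥ :=
    (Submodule.eq_bot_iff _).2 fun x hx => (Submodule.eq_bot_iff _).1 hWC.inf_eq_bot x
      ⟨Submodule.mem_sup_left hx.1, hC₂le hx.2⟩
  have hL : finrank K ↥(I₂ ⊔ C₁) = finrank K I₂ + finrank K C₁ := by
    have := Submodule.finrank_sup_add_finrank_inf_eq I₂ C₁
    rw [hdisj₁, finrank_bot, add_zero] at this
    exact this
  have hM : finrank K ↥(I₁ ⊔ C₂) = finrank K I₁ + finrank K C₂ := by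
    have := Submodule.finrank_sup_add_finrank_inf_eq I₁ C₂
    rw [hdisj₂, finrank_bot, add_zero] at this
    exact this
  have hLag₁ : B.orthogonal (I₂ ⊔ C₁) = I₂ ⊔ C₁ :=
    orthogonal_eq_self_of_isotropic hN (isotropic_sup_of_le_orthogonal hB hI₂ hC₁ hC₁le) (by omega)
  have hLag₂ : B.orthogonal (I₁ ⊔ C₂) = I₁ ⊔ C₂ := by
    refine orthogonal_eq_self_of_isotropic hN ?_ (by omega)
    have h := isotropic_sup_of_le_orthogonal (I₁ := I₂) (I₂ := I₁) (C₁ := C₂) hB hI₁ hC₂ (by rwa [sup_comm])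
    exact h
  -- disjointness: `i₂ + c₁ = i₁ + c₂` forces everything to vanish
  have hinf : (I₂ ⊔ C₁) ⊓ (I₁ ⊔ C₂) = ⊥ := by
    refine (Submodule.eq_bot_iff _).2 fun x hx => ?_
    obtain ⟨i₂, hi₂, c₁, hc₁, rfl⟩ := Submodule.mem_sup.1 hx.1
    obtain ⟨i₁, hi₁, c₂, hc₂, h⟩ := Submodule.mem_sup.1 hx.2
    have hw : i₂ - i₁ ∈ I₁ ⊔ I₂ := sub_mem (Submodule.mem_sup_right hi₂) (Submodule.mem_sup_left hi₁)
    have hc : c₂ - c₁ ∈ B.orthogonal (I₁ ⊔ I₂) := sub_mem (hC₂le hc₂) (hC₁le hc₁)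
    have heq : i₂ - i₁ = c₂ - c₁ := by
      rw [sub_eq_sub_iff_add_eq_add, add_comm c₂ i₁]
      exact h.symm
    have h0 : i₂ - i₁ = 0 := (Submodule.eq_bot_iff _).1 hWC.inf_eq_bot _ ⟨hw, heq ▸ hc⟩
    have hi : i₂ = i₁ := sub_eq_zero.1 h0
    have hc0 : c₂ = c₁ := sub_eq_zero.1 (heq ▸ h0)
    have hi0 : i₂ = 0 := (Submodule.eq_bot_iff _).1 (inf_eq_bot_of_dualPair hI₂ hd₁) i₂ ⟨hi ▸ hi₁, hi₂⟩
    have hc00 : c₁ = 0 := (Submodule.eq_bot_iff _).1 (inf_eq_bot_of_dualPair hC₂ he₁) c₁ ⟨hc₁, hc0 ▸ hc₂⟩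
    rw [hi0, hc00, add_zero]
  refine ⟨hLag₁, hLag₂, IsCompl.of_eq hinf ?_⟩
  -- the dimensions add up
  apply Submodule.eq_top_of_finrank_eq
  have h1 := Submodule.finrank_sup_add_finrank_inf_eq (I₂ ⊔ C₁) (I₁ ⊔ C₂)
  rw [hinf, finrank_bot, add_zero] at h1
  omega

end Assemble


/-! ## §4 The block isomorphism on `I₂ ⊕ C₁`, and THE TRANSITIVITY THEOREM -/

section Main

variable [FiniteDimensional K V] {B : LinearMap.BilinForm K V}

omit [FiniteDimensional K V] in
/-- the sum map `P × Q → P ⊔ Q` is bijective when `P ⊓ Q = ⊥` (internal direct sum). [folklore] -/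
private theorem bijective_coprod_inclusion {P Q : Submodule K V} (h : P ⊓ Q = ⊥) :
    Function.Bijective (LinearMap.coprod (Submodule.inclusion (le_sup_left : P ≤ P ⊔ Q))
      (Submodule.inclusion (le_sup_right : Q ≤ P ⊔ Q))) := by
  constructor
  · rw [injective_iff_map_eq_zero]
    rintro ⟨p, q⟩ hpq
    have hv : (p : V) + q = 0 := by
      have := congrArg Subtype.val hpq
      simpa [LinearMap.coprod_apply] using this
    have hp : (p : V) ∈ P ⊓ Q := ⟨p.2, by rw [eq_neg_of_add_eq_zero_left hv]; exact Q.neg_mem q.2⟩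
    rw [h] at hp
    have hp0 : (p : V) = 0 := (Submodule.mem_bot K).1 hp
    have hq0 : (q : V) = 0 := by rwa [hp0, zero_add] at hv
    exact Prod.ext (Subtype.ext hp0) (Subtype.ext hq0)
  · rintro ⟨x, hx⟩
    obtain ⟨p, hp, q, hq, rfl⟩ := Submodule.mem_sup.1 hx
    exact ⟨(⟨p, hp⟩, ⟨q, hq⟩), Subtype.ext (by simp [LinearMap.coprod_apply])⟩

/-- **block isomorphism of internal direct sums**: `P ⊕ Q ≃ P' ⊕ Q'` carrying `P` into `P'` and `Q` into `Q'`, for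
`dim P = dim P'`, `dim Q = dim Q'`. [folklore] -/
private theorem exists_linearEquiv_sup_mapsTo {P Q P' Q' : Submodule K V} (h : P ⊓ Q = ⊥) (h' : P' ⊓ Q' = ⊥)
    (hP : finrank K P = finrank K P') (hQ : finrank K Q = finrank K Q') :
    ∃ a : ↥(P ⊔ Q) ≃ₗ[K] ↥(P' ⊔ Q'),
      (∀ x : ↥(P ⊔ Q), (x : V) ∈ P → (a x : V) ∈ P') ∧ (∀ x : ↥(P ⊔ Q), (x : V) ∈ Q → (a x : V) ∈ Q') := by
  set σ := LinearEquiv.ofBijective _ (bijective_coprod_inclusion h) with hσ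
  set σ' := LinearEquiv.ofBijective _ (bijective_coprod_inclusion h') with hσ'
  set eP : ↥P ≃ₗ[K] ↥P' := LinearEquiv.ofFinrankEq _ _ hP
  set eQ : ↥Q ≃ₗ[K] ↥Q' := LinearEquiv.ofFinrankEq _ _ hQ
  refine ⟨σ.symm.trans ((eP.prodCongr eQ).trans σ'), fun x hx => ?_, fun x hx => ?_⟩
  · have hsx : σ.symm x = (⟨x, hx⟩, 0) := by
      rw [LinearEquiv.symm_apply_eq]
      exact Subtype.ext (by simp [hσ, LinearMap.coprod_apply])
    simp only [LinearEquiv.trans_apply, hsx, LinearEquiv.prodCongr_apply, map_zero, hσ', LinearEquiv.ofBijective_apply,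
      LinearMap.coprod_apply, Submodule.coe_inclusion, add_zero]
    exact (eP ⟨x, hx⟩).2
  · have hsx : σ.symm x = (0, ⟨x, hx⟩) := by
      rw [LinearEquiv.symm_apply_eq]
      exact Subtype.ext (by simp [hσ, LinearMap.coprod_apply])
    simp only [LinearEquiv.trans_apply, hsx, LinearEquiv.prodCongr_apply, map_zero, hσ', LinearEquiv.ofBijective_apply,
      LinearMap.coprod_apply, Submodule.coe_inclusion, zero_add]
    exact (eQ ⟨x, hx⟩).2

/-- **`Sp(B)` ACTS TRANSITIVELY ON DUAL PAIRS OF ISOTROPIC SUBSPACES (Witt extension for an alternating form).**  Let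
`B` be alternating and non-degenerate on the finite-dimensional `K`-space `V`.  A DUAL ISOTROPIC PAIR is a pair
`(I₁, I₂)` of isotropic subspaces (`B = 0` on each) in perfect duality under `B` (`I₁ ⊓ I₂ᗮ = ⊥`, `I₂ ⊓ I₁ᗮ = ⊥`;
then `dim I₁ = dim I₂`, `I₁ ⊓ I₂ = ⊥` and `I₁ ⊕ I₂` is a non-degenerate subspace, §1).  For two dual isotropic pairs
`(I₁, I₂)`, `(I₁', I₂')` with `dim I₁ = dim I₁'` there is an ISOMETRY `g ∈ Sp(B)` with `g I₁ = I₁'` and `g I₂ = I₂'`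
(hence also `g (I₁ ⊕ I₂)ᗮ = (I₁' ⊕ I₂')ᗮ`).  Proof: Darboux splits `(I₁ ⊕ I₂)ᗮ = C₁ ⊕ C₂` into a dual isotropic pair
(§2); `(I₂ ⊕ C₁, I₁ ⊕ C₂)` is a transversal Lagrangian pair (§3); [Rangarao1993, Lemma 2.1 (iv)] (`extendSp`,
`LagrangianTransitive.lean`) extends the block isomorphism `I₂ ⊕ C₁ ≃ I₂' ⊕ C₁'` to an isometry `g` carrying
`I₁ ⊕ C₂` onto `I₁' ⊕ C₂'`; then `g I₁ = (I₁' ⊕ C₂') ⊓ (C₁')ᗮ = I₁'`.  (The polarisation mover of the cell's IV-4(c1) line: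
it carries the pair `(im 𝔫̄, im 𝔫)` of a root element and its opposite onto a standard pair `(X₁ × 0, 0 × Y₁)`.)
[cite: Rangarao1993, §2.1 Lemma 2.1 (iii)–(iv), §2.2 p. 338] -/
theorem exists_isometry_map_dualPair_eq (hB : LinearMap.IsAlt B) (hN : B.Nondegenerate) {I₁ I₂ I₁' I₂' : Submodule K V}
    (hI₁ : ∀ x ∈ I₁, ∀ y ∈ I₁, B x y = 0) (hI₂ : ∀ x ∈ I₂, ∀ y ∈ I₂, B x y = 0)
    (hd₁ : Disjoint I₁ (B.orthogonal I₂)) (hd₂ : Disjoint I₂ (B.orthogonal I₁))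
    (hI₁' : ∀ x ∈ I₁', ∀ y ∈ I₁', B x y = 0) (hI₂' : ∀ x ∈ I₂', ∀ y ∈ I₂', B x y = 0)
    (hd₁' : Disjoint I₁' (B.orthogonal I₂')) (hd₂' : Disjoint I₂' (B.orthogonal I₁'))
    (hdim : finrank K I₁ = finrank K I₁') :
    ∃ g ∈ Heisenberg.PseudoSymplectic.isometries B,
      I₁.map (g : V →ₗ[K] V) = I₁' ∧ I₂.map (g : V →ₗ[K] V) = I₂' := by
  -- §1/§2: the complements and their Darboux dual pairs
  have hWC := isCompl_sup_orthogonal_of_dualPair hB hI₁ hI₂ hd₁ hd₂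
  have hWC' := isCompl_sup_orthogonal_of_dualPair hB hI₁' hI₂' hd₁' hd₂'
  have hCC : IsCompl (B.orthogonal (I₁ ⊔ I₂)) (B.orthogonal (B.orthogonal (I₁ ⊔ I₂))) := by
    rw [LinearMap.BilinForm.orthogonal_orthogonal hN hB.isRefl]; exact hWC.symm
  have hCC' : IsCompl (B.orthogonal (I₁' ⊔ I₂')) (B.orthogonal (B.orthogonal (I₁' ⊔ I₂'))) := by
    rw [LinearMap.BilinForm.orthogonal_orthogonal hN hB.isRefl]; exact hWC'.symm
  obtain ⟨C₁, C₂, hC₁le, hC₂le, hC₁, hC₂, he₁, he₂, hsup⟩ := exists_dualPair_sup_eq hB hCC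
  obtain ⟨C₁', C₂', hC₁le', hC₂le', hC₁', hC₂', he₁', he₂', hsup'⟩ := exists_dualPair_sup_eq hB hCC'
  -- §3: the transversal Lagrangian pairs
  obtain ⟨hL, hM, hLM⟩ := lagrangianPair_of_dualPairs hB hN hI₁ hI₂ hd₁ hd₂ hC₁ hC₂ he₁ he₂ hsup
  obtain ⟨hL', hM', hLM'⟩ := lagrangianPair_of_dualPairs hB hN hI₁' hI₂' hd₁' hd₂' hC₁' hC₂' he₁' he₂' hsup'
  -- dimensions
  have h12 := finrank_eq_of_dualPair hN hd₁ hd₂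
  have h12' := finrank_eq_of_dualPair hN hd₁' hd₂'
  have hW := finrank_sup_of_dualPair hN hI₂ hd₁ hd₂
  have hW' := finrank_sup_of_dualPair hN hI₂' hd₁' hd₂'
  have hC : finrank K ↥(C₁ ⊔ C₂) = 2 * finrank K C₁ := finrank_sup_of_dualPair hN hC₂ he₁ he₂
  have hC' : finrank K ↥(C₁' ⊔ C₂') = 2 * finrank K C₁' := finrank_sup_of_dualPair hN hC₂' he₁' he₂'
  have hV := Submodule.finrank_add_eq_of_isCompl hWC
  have hV' := Submodule.finrank_add_eq_of_isCompl hWC'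
  rw [← hsup] at hV
  rw [← hsup'] at hV'
  have hdisj : I₂ ⊓ C₁ = ⊥ :=
    (Submodule.eq_bot_iff _).2 fun x hx => (Submodule.eq_bot_iff _).1 hWC.inf_eq_bot x
      ⟨Submodule.mem_sup_right hx.1, (hsup ▸ le_sup_left : C₁ ≤ _) hx.2⟩
  have hdisj' : I₂' ⊓ C₁' = ⊥ :=
    (Submodule.eq_bot_iff _).2 fun x hx => (Submodule.eq_bot_iff _).1 hWC'.inf_eq_bot x
      ⟨Submodule.mem_sup_right hx.1, (hsup' ▸ le_sup_left : C₁' ≤ _) hx.2⟩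
  -- §4: the block isomorphism and its extension to an isometry
  obtain ⟨a, haP, haQ⟩ := exists_linearEquiv_sup_mapsTo (P := I₂) (Q := C₁) (P' := I₂') (Q' := C₁') hdisj hdisj'
    (by omega) (by omega)
  obtain ⟨g, hg, hga, -, hgM⟩ := exists_isometry_extending hB hN hL hM hLM hL' hM' hLM' a
  have hgB : ∀ v w : V, B (g v) (g w) = B v w := (Heisenberg.PseudoSymplectic.mem_isometries B g).1 hg
  -- `g I₂ = I₂'`, `g C₁ = C₁'`
  have hgI₂ : I₂.map (g : V →ₗ[K] V) = I₂' := by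
    refine Submodule.eq_of_le_of_finrank_eq (Submodule.map_le_iff_le_comap.2 fun x hx => ?_) ?_
    · have h := hga ⟨x, Submodule.mem_sup_left hx⟩
      change (g : V →ₗ[K] V) x ∈ I₂'
      rw [LinearEquiv.coe_coe, h]
      exact haP _ hx
    · rw [LinearEquiv.finrank_map_eq]; omega
  have hgC₁ : C₁.map (g : V →ₗ[K] V) = C₁' := by
    refine Submodule.eq_of_le_of_finrank_eq (Submodule.map_le_iff_le_comap.2 fun x hx => ?_) ?_
    · have h := hga ⟨x, Submodule.mem_sup_right hx⟩
      change (g : V →ₗ[K] V) x ∈ C₁'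
      rw [LinearEquiv.coe_coe, h]
      exact haQ _ hx
    · rw [LinearEquiv.finrank_map_eq]; omega
  refine ⟨g, hg, ?_, hgI₂⟩
  -- `g I₁ ≤ (I₁' ⊕ C₂') ⊓ (C₁')ᗮ = I₁'`
  refine Submodule.eq_of_le_of_finrank_eq (Submodule.map_le_iff_le_comap.2 fun x hx => ?_) ?_
  swap
  · rw [LinearEquiv.finrank_map_eq]; exact hdim
  change (g : V →ₗ[K] V) x ∈ I₁'
  rw [LinearEquiv.coe_coe]
  have hxM : g x ∈ I₁' ⊔ C₂' := by
    rw [← hgM]; exact Submodule.mem_map_of_mem (Submodule.mem_sup_left hx)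
  obtain ⟨i', hi', c', hc', hsum⟩ := Submodule.mem_sup.1 hxM
  -- `g x` and `i'` are orthogonal to `C₁'`, hence so is `c'`
  have hgx : ∀ z ∈ C₁', B z (g x) = 0 := by
    intro z hz
    rw [← hgC₁] at hz
    obtain ⟨c, hc, rfl⟩ := Submodule.mem_map.1 hz
    rw [LinearEquiv.coe_coe, hgB]
    exact hB.isRefl _ _
      ((LinearMap.BilinForm.mem_orthogonal_iff.1 ((hsup ▸ le_sup_left : C₁ ≤ _) hc)) x (Submodule.mem_sup_left hx))
  have hc'0 : c' = 0 := by
    refine (Submodule.eq_bot_iff _).1 he₂'.eq_bot c' ⟨hc', (LinearMap.BilinForm.mem_orthogonal_iff).2 fun z hz => ?_⟩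
    have h1 : B z i' = 0 := hB.isRefl _ _
      ((LinearMap.BilinForm.mem_orthogonal_iff.1 ((hsup' ▸ le_sup_left : C₁' ≤ _) hz)) i' (Submodule.mem_sup_left hi'))
    have h2 := hgx z hz
    rw [← hsum, map_add, h1, zero_add] at h2
    exact h2
  rw [← hsum, hc'0, add_zero]
  exact hi'

omit [FiniteDimensional K V] in
/-- an isometry carries orthogonal complements to orthogonal complements: `g (Wᗮ) = (g W)ᗮ`. [cite: Rangarao1993, §2.2 p. 338] -/
theorem map_orthogonal_eq_of_mem_isometries {g : V ≃ₗ[K] V} (hg : g ∈ Heisenberg.PseudoSymplectic.isometries B)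
    (W : Submodule K V) : (B.orthogonal W).map (g : V →ₗ[K] V) = B.orthogonal (W.map (g : V →ₗ[K] V)) := by
  have hgB : ∀ v w : V, B (g v) (g w) = B v w := (Heisenberg.PseudoSymplectic.mem_isometries B g).1 hg
  ext y
  constructor
  · rintro ⟨z, hz, rfl⟩
    rw [LinearMap.BilinForm.mem_orthogonal_iff]
    rintro _ ⟨w, hw, rfl⟩
    change B (g w) (g z) = 0
    rw [hgB]
    exact (LinearMap.BilinForm.mem_orthogonal_iff.1 hz) w hw
  · intro hy
    refine ⟨g.symm y, (LinearMap.BilinForm.mem_orthogonal_iff).2 fun w hw => ?_, by simp⟩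
    have h := (LinearMap.BilinForm.mem_orthogonal_iff.1 hy) (g w) ⟨w, hw, rfl⟩
    change B (g w) y = 0 at h
    rw [← g.apply_symm_apply y, hgB] at h
    exact h

/-- … and therefore also the common orthogonal complements correspond: `g (I₁ ⊕ I₂)ᗮ = (I₁' ⊕ I₂')ᗮ` for the
isometry of `exists_isometry_map_dualPair_eq`. [cite: Rangarao1993, §2.1 Lemma 2.1 (iv), §2.2 p. 338] -/
theorem exists_isometry_map_dualPair_eq' (hB : LinearMap.IsAlt B) (hN : B.Nondegenerate) {I₁ I₂ I₁' I₂' : Submodule K V}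
    (hI₁ : ∀ x ∈ I₁, ∀ y ∈ I₁, B x y = 0) (hI₂ : ∀ x ∈ I₂, ∀ y ∈ I₂, B x y = 0)
    (hd₁ : Disjoint I₁ (B.orthogonal I₂)) (hd₂ : Disjoint I₂ (B.orthogonal I₁))
    (hI₁' : ∀ x ∈ I₁', ∀ y ∈ I₁', B x y = 0) (hI₂' : ∀ x ∈ I₂', ∀ y ∈ I₂', B x y = 0)
    (hd₁' : Disjoint I₁' (B.orthogonal I₂')) (hd₂' : Disjoint I₂' (B.orthogonal I₁'))
    (hdim : finrank K I₁ = finrank K I₁') :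
    ∃ g ∈ Heisenberg.PseudoSymplectic.isometries B,
      I₁.map (g : V →ₗ[K] V) = I₁' ∧ I₂.map (g : V →ₗ[K] V) = I₂' ∧
        (B.orthogonal (I₁ ⊔ I₂)).map (g : V →ₗ[K] V) = B.orthogonal (I₁' ⊔ I₂') := by
  obtain ⟨g, hg, h₁, h₂⟩ := exists_isometry_map_dualPair_eq hB hN hI₁ hI₂ hd₁ hd₂ hI₁' hI₂' hd₁' hd₂' hdim
  refine ⟨g, hg, h₁, h₂, ?_⟩
  rw [map_orthogonal_eq_of_mem_isometries hg, Submodule.map_sup, h₁, h₂]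

end Main

end Literature.LinearAlgebra.QuadraticForm
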